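import Summits.QuantumFields.YangMills.Theorems.UnitScaleTiltProp7SymAvgTwDefs
import Summits.QuantumFields.YangMills.Theorems.UnitScaleTiltProp7LatticeBoxPoincareCov
import HarnessLib

/-!
# Route `UnitScaleTilt`, crux K1 (stmt-QuantumFields-19200), LANE II (QB) ∕ (R-LEGS): COUNTING ROW (L1) of ✓`rlegs_flat_Zd_of_counting` —
# the top-box energy of the pulled-back field is at most `(4L²+2)³` times the torus gradient energy over the box's torus image
Cell `ym3-torus`, width seat `ym3-torus-px19` (gen 6; pen (R-LEGS)).  THEOREMS ONLY (0 `def`, 0 `sorry`); `--supports stmt-QuantumFields-19200 --as helper`, count-neutral.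
YM₃ on T³ is a ladder rung (R3), not d = 4, not Clay; nothing here claims a stub, the crux or the gap.  Pure lattice counting: the pull-back `z ↦ transl x₀ z` is
`N_K`-periodic per coordinate and the box has side `4L²ℓ + 1 ≤ (4L²+1)·N_K` (`N_K = 2L^{m+K} ≥ ℓ = L^{K−n}`), so each torus site has at most `(4L²+2)³` preimages in the box.
PROVED (ns `…Prop7CornerFrameLegsFlatCountL1`): `card_fibre_transl_box_le`, ★`topBox_energy_le_image` (= the displayed (L1) of F3c with `μ₁ L = (4L²+2)³`).
References: T. Bałaban, CMP 109 (1987) 249–301 [Balaban1987RG1] ((0.1) p.251); CMP 98 (1985) 17–51 [Balaban1985Averaging] ((110) p.34).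
-/

set_option autoImplicit false

noncomputable section

open scoped BigOperators Matrix.Norms.L2Operator
open Finset

namespace Summit.QuantumFields.YangMills.Theorems.Prop7CornerFrameLegsFlatCountL1

open Literature.MathematicalPhysics.QuantumFieldTheory.Balaban1983to89
open Literature.MathematicalPhysics.QuantumFieldTheory.Balaban1983to89.T3ContinuumYM3Torus
open Literature.MathematicalPhysics.QuantumFieldTheory.Balaban1983to89.B4Eq19LatticeOperators (Zd box unitVec mem_box)
open B7Prop1Explicit (e)
open B10Eq27TorusAxialLog (transl transl_apply transl_add_e)
open Summit.QuantumFields.YangMills.Theorems.Prop7SPrint (basePt)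
open Summit.QuantumFields.YangMills.Theorems.Prop7SymAvgTw (coordT3)

variable {F : T3Family} {n K : ℕ}

/-- `N_K = 2L^{m+K} ≥ L^{K−n}`: the fine torus is at least one block long. [cite: Balaban1987RG1, (0.1) p.251] -/
theorem ell_le_sitesPerDir (h : n ≤ K) : (F.P K).L ^ (K - n) ≤ (F.P K).sitesPerDir 0 := by
  simp only [Params.sitesPerDir, T3Family.P_eq_PP, T3Family.PP_L, T3Family.PP_m, T3Family.PP_K, Nat.sub_zero]
  have hL : 1 ≤ F.L := by have := F.hL.2; omega
  calc F.L ^ (K - n) ≤ F.L ^ (F.m + K) := Nat.pow_le_pow_right hL (by omega)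
    _ ≤ 2 * F.L ^ (F.m + K) := by omega

/-- ★ **THE FIBRES OF THE PULL-BACK ON A BOX**: for any centre `c`, radius `R` with `2R ≤ (4L²+1)·N_K`… concretely `R = 2L^{K−n+2}`: every torus site has at most `(4L²+2)³` preimages
`z ∈ box c R` under `z ↦ transl x₀ z` (per coordinate: equal residues mod `N_K` in a window of length `2R+1`). [cite: Balaban1987RG1, (0.1) p.251] -/
theorem card_fibre_transl_box_le (h : n ≤ K) (c : Zd 3) (x : Site (F.P K) 0) :
    ((box c (2 * (((F.P K).L ^ (K - n + 2) : ℕ) : ℤ))).filter (fun z : Zd 3 => transl (basePt F n K) z = x)).card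
      ≤ (4 * (F.P K).L ^ 2 + 2) ^ 3 := by
  classical
  set R : ℤ := 2 * (((F.P K).L ^ (K - n + 2) : ℕ) : ℤ) with hR
  set NK : ℕ := (F.P K).sitesPerDir 0 with hNK
  have hNK0 : 0 < NK := Nat.pos_of_ne_zero ((F.P K).sitesPerDir_ne_zero 0)
  have hNKz : (0 : ℤ) < (NK : ℤ) := by exact_mod_cast hNK0
  -- the window quotient: `q z i = (z i − (c i − R)) / N_K ∈ [0, 4L²+1]`
  have hquot : ∀ z ∈ box c R, ∀ i : Fin 3, 0 ≤ (z i - (c i - R)) / (NK : ℤ) ∧ (z i - (c i - R)) / (NK : ℤ) < 4 * (F.P K).L ^ 2 + 2 := by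
    intro z hz i
    rw [mem_box] at hz
    have hzi := hz i
    have h0 : 0 ≤ z i - (c i - R) := by have := abs_le.mp hzi; linarith
    have h2R : z i - (c i - R) ≤ 2 * R := by have := abs_le.mp hzi; linarith
    refine ⟨Int.ediv_nonneg h0 hNKz.le, ?_⟩
    -- `2R < (4L²+2)·N_K` since `ℓ ≤ N_K`
    have hell : (((F.P K).L ^ (K - n) : ℕ) : ℤ) ≤ (NK : ℤ) := by exact_mod_cast ell_le_sitesPerDir (F := F) h
    have hRval : R = 2 * ((F.P K).L : ℤ) ^ 2 * (((F.P K).L ^ (K - n) : ℕ) : ℤ) := by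
      rw [hR]; push_cast; ring
    have hlt : z i - (c i - R) < (4 * ((F.P K).L : ℤ) ^ 2 + 2) * (NK : ℤ) := by
      have hL2 : (0 : ℤ) ≤ ((F.P K).L : ℤ) ^ 2 := sq_nonneg _
      nlinarith
    have := Int.ediv_lt_iff_lt_mul hNKz |>.mpr hlt
    exact_mod_cast this
  -- the injection into `Fin 3 → Fin (4L²+2)`
  let φ : Zd 3 → (Fin 3 → Fin (4 * (F.P K).L ^ 2 + 2)) := fun z i =>
    ⟨((z i - (c i - R)) / (NK : ℤ)).toNat % (4 * (F.P K).L ^ 2 + 2), Nat.mod_lt _ (by positivity)⟩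
  have hinj : Set.InjOn φ ↑((box c R).filter (fun z : Zd 3 => transl (basePt F n K) z = x)) := by
    intro z hz z' hz' hφ
    simp only [Finset.coe_filter, Set.mem_setOf_eq] at hz hz'
    funext i
    have hq := hquot z hz.1 i
    have hq' := hquot z' hz'.1 i
    -- equal residues mod `N_K`
    have hres : ((z i : ℤ) : ZMod NK) = ((z' i : ℤ) : ZMod NK) := by
      have h1 := congrFun hz.2 i
      have h2 := congrFun hz'.2 i
      rw [transl_apply] at h1 h2
      have := h1.trans h2.symm
      exact add_left_cancel this
    have hdvd : (NK : ℤ) ∣ (z i - z' i) := (ZMod.intCast_eq_intCast_iff_dvd_sub _ _ _).mp hres.symm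
    -- equal quotients
    have hφi : ((z i - (c i - R)) / (NK : ℤ)).toNat % (4 * (F.P K).L ^ 2 + 2) = ((z' i - (c i - R)) / (NK : ℤ)).toNat % (4 * (F.P K).L ^ 2 + 2) := by
      have := congrFun hφ i
      simp only [φ, Fin.mk.injEq] at this
      exact this
    have hq1 : ((z i - (c i - R)) / (NK : ℤ)).toNat < 4 * (F.P K).L ^ 2 + 2 := by
      have h0 := Int.toNat_of_nonneg hq.1
      have : ((((z i - (c i - R)) / (NK : ℤ)).toNat : ℕ) : ℤ) < ((4 * (F.P K).L ^ 2 + 2 : ℕ) : ℤ) := by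
        rw [h0]; push_cast; exact hq.2
      exact_mod_cast this
    have hq2 : ((z' i - (c i - R)) / (NK : ℤ)).toNat < 4 * (F.P K).L ^ 2 + 2 := by
      have h0 := Int.toNat_of_nonneg hq'.1
      have : ((((z' i - (c i - R)) / (NK : ℤ)).toNat : ℕ) : ℤ) < ((4 * (F.P K).L ^ 2 + 2 : ℕ) : ℤ) := by
        rw [h0]; push_cast; exact hq'.2
      exact_mod_cast this
    rw [Nat.mod_eq_of_lt hq1, Nat.mod_eq_of_lt hq2] at hφi
    have hqq : (z i - (c i - R)) / (NK : ℤ) = (z' i - (c i - R)) / (NK : ℤ) := by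
      have a := Int.toNat_of_nonneg hq.1
      have b := Int.toNat_of_nonneg hq'.1
      omega
    -- conclude
    obtain ⟨m, hm⟩ := hdvd
    have e1 := Int.emod_add_ediv_mul (z i - (c i - R)) (NK : ℤ)
    have e2 := Int.emod_add_ediv_mul (z' i - (c i - R)) (NK : ℤ)
    have hmod : (z i - (c i - R)) % (NK : ℤ) = (z' i - (c i - R)) % (NK : ℤ) := by
      have : z i - (c i - R) = (z' i - (c i - R)) + (NK : ℤ) * m := by linarith
      rw [this, Int.add_mul_emod_self_left]
    have hprod : (z i - (c i - R)) / (NK : ℤ) * (NK : ℤ) = (z' i - (c i - R)) / (NK : ℤ) * (NK : ℤ) := by rw [hqq]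
    linarith
  calc ((box c R).filter (fun z : Zd 3 => transl (basePt F n K) z = x)).card
      = (((box c R).filter (fun z : Zd 3 => transl (basePt F n K) z = x)).image φ).card := (Finset.card_image_of_injOn hinj).symm
    _ ≤ (Finset.univ : Finset (Fin 3 → Fin (4 * (F.P K).L ^ 2 + 2))).card := Finset.card_le_card (Finset.subset_univ _)
    _ = (4 * (F.P K).L ^ 2 + 2) ^ 3 := by rw [Finset.card_univ, Fintype.card_fun, Fintype.card_fin, Fintype.card_fin]

/-- ★ **(L1) THE TOP-BOX ENERGY AGAINST THE TORUS IMAGE** (`μ₁ L = (4L²+2)³`): drop the indicator, read `X♯(z + e_ν) = X⟨(transl x₀ z) + e_ν⟩` (lit ✓`transl_add_e`), and count the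
fibres of the pull-back on the box (`card_fibre_transl_box_le`). [cite: Balaban1987RG1, (0.1) p.251; Balaban1985Averaging, (110) p.34] -/
theorem topBox_energy_le_image (h : n ≤ K) (y : Site (F.P n) 0) (X : PBond (F.P K) 0 → Matrix (Fin 2) (Fin 2) ℂ) :
    ∑ κ : Fin 3, ∑ z ∈ box (((((F.P K).L ^ (K - n) : ℕ) : ℤ)) • (fun i : Fin 3 => coordT3 F n K h y i)) (2 * (((F.P K).L ^ (K - n + 2) : ℕ) : ℤ)),
        ∑ ν : Fin 3,
          (if z + unitVec ν ∈ box (((((F.P K).L ^ (K - n) : ℕ) : ℤ)) • (fun i : Fin 3 => coordT3 F n K h y i)) (2 * (((F.P K).L ^ (K - n + 2) : ℕ) : ℤ))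
            then ‖X ⟨transl (basePt F n K) (z + unitVec ν), κ⟩ - X ⟨transl (basePt F n K) z, κ⟩‖ ^ 2 else 0)
      ≤ ((4 * ((F.P K).L : ℝ) ^ 2 + 2) ^ 3)
          * ∑ x ∈ (box (((((F.P K).L ^ (K - n) : ℕ) : ℤ)) • (fun i : Fin 3 => coordT3 F n K h y i)) (2 * (((F.P K).L ^ (K - n + 2) : ℕ) : ℤ))).image
              (fun z : Zd 3 => transl (basePt F n K) z),
            ∑ κ : Fin 3, ∑ ν : Fin 3, ‖X ⟨x.shift ν, κ⟩ - X ⟨x, κ⟩‖ ^ 2 := by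
  classical
  set B := box (((((F.P K).L ^ (K - n) : ℕ) : ℤ)) • (fun i : Fin 3 => coordT3 F n K h y i)) (2 * (((F.P K).L ^ (K - n + 2) : ℕ) : ℤ)) with hB
  set T : Zd 3 → Site (F.P K) 0 := fun z => transl (basePt F n K) z with hT
  set G : Site (F.P K) 0 → ℝ := fun x => ∑ κ : Fin 3, ∑ ν : Fin 3, ‖X ⟨x.shift ν, κ⟩ - X ⟨x, κ⟩‖ ^ 2 with hG
  have hG0 : ∀ x, 0 ≤ G x := fun x => Finset.sum_nonneg fun _ _ => Finset.sum_nonneg fun _ _ => sq_nonneg _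
  -- (i) drop the indicator and read through the torus
  have h1 : ∑ κ : Fin 3, ∑ z ∈ B, ∑ ν : Fin 3,
          (if z + unitVec ν ∈ B then ‖X ⟨transl (basePt F n K) (z + unitVec ν), κ⟩ - X ⟨transl (basePt F n K) z, κ⟩‖ ^ 2 else 0)
      ≤ ∑ z ∈ B, G (T z) := by
    rw [Finset.sum_comm]
    refine Finset.sum_le_sum fun z _ => ?_
    simp only [hG, hT]
    refine Finset.sum_le_sum fun κ _ => Finset.sum_le_sum fun ν _ => ?_
    have he : transl (basePt F n K) (z + unitVec ν) = (transl (basePt F n K) z).shift ν := transl_add_e _ _ _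
    split_ifs
    · rw [he]
    · positivity
  -- (ii) fibrewise
  have h2 : ∑ z ∈ B, G (T z) = ∑ x ∈ B.image T, ((B.filter (fun z => T z = x)).card : ℝ) * G x := by
    rw [Finset.sum_comp]
    refine Finset.sum_congr rfl fun x _ => ?_
    rw [nsmul_eq_mul]
  -- (iii) the fibre bound
  have h3 : ∑ x ∈ B.image T, ((B.filter (fun z => T z = x)).card : ℝ) * G x
      ≤ ∑ x ∈ B.image T, ((4 * ((F.P K).L : ℝ) ^ 2 + 2) ^ 3) * G x := by
    refine Finset.sum_le_sum fun x _ => mul_le_mul_of_nonneg_right ?_ (hG0 x)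
    have := card_fibre_transl_box_le (F := F) h ((((F.P K).L ^ (K - n) : ℕ) : ℤ) • (fun i : Fin 3 => coordT3 F n K h y i)) x
    exact_mod_cast this
  rw [← Finset.mul_sum] at h3
  exact h1.trans (h2.le.trans h3)

end Summit.QuantumFields.YangMills.Theorems.Prop7CornerFrameLegsFlatCountL1

end
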